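import Summits.QuantumFields.YangMills.Theorems.SwapVirialDeficitEndCoreProductFloor
import HarnessLib

/-!
# Route `SwapVirialDeficit` (YangMills): APEX ISOTROPY OF THE GNOMONIC CHART AT A REAL HUB (brick (T3) of w2 g60's plan for `stub_core_tip` of skeleton ➎;
# cell ym-idea-1, LEAD g99 free hands, 2026-08-31)

At a REAL hub `a = (r : ℍ)`, `r ≠ 0`, the arranged hub unit is `radialUnit (axisPoint r) = ±1`, so the slaved letter is `slaveP (±1) x = x̂` and the chart point
`blowUpPoint 1 (gnomonicPoint r ε η)` has leaders `(x̂, Q(x̂·z), ŷ, ±1)` and followers `Q(±(1, η_f))`.  Rotating EVERY gnomonic letter (leaders `x, y, z` and all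
followers) by the rotation `v ↦ rot3 u v` of a unit quaternion `u` (`(1, rot3 u v) = ū (1, v) u`) conjugates every chart component by `(quatToSU2 u)⁻¹`
(★ `blowUpPoint_gnomonicPoint_realHub_rot`), hence leaves the σ-glued deficit invariant for a central background (★★ `gnoDeficit_realHub_rot`, from
✓`chartDeficit_conj`).  This is the device by which LOCAL determinant matching reaches the tilted apex family (w2 g60 21:38Z (T3); LEAD memo10b/10c).
* §1 `rot3`, `gnoRot` (definitions) and their algebra: `gnomonicQuat_rot3`, `gnoLetter_rot3`, `rot3_add`, `rot3_smul`, `rot3_zero`, `normSq3_rot3`;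
* §2 the chart point at a real hub and its conjugation; §3 the invariance of `gnoDeficit`.

HONEST LABEL: two definitions + symmetry bookkeeping; `stub_core_tip`, `stub_core_end`, `stub_B_stiff`, `stub_h001_good`, ⟨24197⟩ ∕ ⟨24194⟩ OPEN; own crux ⟨22884⟩
`LargeFieldMassRefinementTail` OPEN (blocked-on ⟨19935⟩); the Yang–Mills mass gap is NOT proved; no summit is proved by a line.  No new instance (the local
quaternion measurability instances are the route's standard ones), no notation, 0 `sorry`, standard axioms.  `--supports stmt-QuantumFields-24197`.
References: [cite: tHooft1979]; [cite: Luscher1983, §2]; [folklore].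
-/

set_option autoImplicit false
set_option synthInstance.maxSize 1024

noncomputable section

open MeasureTheory Set
open scoped Quaternion BigOperators
open Literature.MathematicalPhysics.QuantumLattice
open Literature.MathematicalPhysics.QuantumFieldTheory hiding SU2

namespace Summit.QuantumFields.YangMills.Theorems.SwapVirialDeficit.BlowUpRing

open Summit.QuantumFields.YangMills.Theorems.FemtoTransferGap
open Literature.Analysis.Calculus (radialUnit radialUnit_def norm_radialUnit)
open Summit.QuantumFields.YangMills.Theorems.SwapTwistDeficit.ToronLog (axisPoint)
open Summit.QuantumFields.YangMills.Theorems.SwapVirialDeficit.ZeroModeSigma (slaveP radialUnit_conj dil3 dilateIm radialUnit_coe_of_pos radialUnit_coe_of_neg)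
open Summit.QuantumFields.YangMills.Theorems.SwapVirialDeficit.Gnomonic (normSq3)
open Summit.QuantumFields.YangMills.Theorems.SwapVirialDeficit.BlowUp (leaderTuple leaderTuple_apply quatToSU2_conj_unit dilateIm_one_apply dil3_one')

variable {L : ℕ} [NeZero L]

/-! ## §1 The rotation of a unit quaternion on gnomonic letters -/

/-- THE ROTATION `rot3 u` OF `ℝ³` of a (unit) quaternion `u`: `rot3 u v` is the vector part of `ū·(1, v)·u`. [folklore] -/
def rot3 (u : ℍ) (v : Fin 3 → ℝ) : Fin 3 → ℝ :=
  ![(star u * gnomonicQuat v * u).imI, (star u * gnomonicQuat v * u).imJ, (star u * gnomonicQuat v * u).imK]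

/-- `rot3 u` ON ALL GNOMONIC COORDINATES (leaders `x, y, z` and every follower). [folklore] -/
def gnoRot (u : ℍ) (η : GnoCoord L) : GnoCoord L :=
  ((rot3 u η.1.1, rot3 u η.1.2), rot3 u η.2.1, fun f => rot3 u (η.2.2 f))

omit [NeZero L] in
/-- Components of `gnoRot`. [folklore] -/
theorem gnoRot_apply (u : ℍ) (η : GnoCoord L) :
    (gnoRot u η).1.1 = rot3 u η.1.1 ∧ (gnoRot u η).1.2 = rot3 u η.1.2 ∧ (gnoRot u η).2.1 = rot3 u η.2.1 ∧ ∀ f, (gnoRot u η).2.2 f = rot3 u (η.2.2 f) :=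
  ⟨rfl, rfl, rfl, fun _ => rfl⟩

/-- The real part of `ū·(1, v)·u` is `1` for a unit `u`. [folklore] -/
theorem re_conj_gnomonicQuat {u : ℍ} (hu : ‖u‖ = 1) (v : Fin 3 → ℝ) : (star u * gnomonicQuat v * u).re = 1 := by
  have hn : u.re ^ 2 + u.imI ^ 2 + u.imJ ^ 2 + u.imK ^ 2 = 1 := by
    have h := Quaternion.normSq_eq_norm_mul_self u
    rw [hu, mul_one, Quaternion.normSq_def'] at h
    nlinarith [h]
  simp only [gnomonicQuat, Quaternion.re_mul, Quaternion.imI_mul, Quaternion.imJ_mul, Quaternion.imK_mul, Quaternion.re_star, Quaternion.imI_star,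
    Quaternion.imJ_star, Quaternion.imK_star]
  linear_combination hn

/-- ★ `(1, rot3 u v) = ū·(1, v)·u` for a unit `u`. [folklore] -/
theorem gnomonicQuat_rot3 {u : ℍ} (hu : ‖u‖ = 1) (v : Fin 3 → ℝ) : gnomonicQuat (rot3 u v) = star u * gnomonicQuat v * u := by
  have hre := re_conj_gnomonicQuat hu v
  ext
  · simpa [gnomonicQuat] using hre.symm
  · simp [gnomonicQuat, rot3]
  · simp [gnomonicQuat, rot3]
  · simp [gnomonicQuat, rot3]

omit [NeZero L] in
/-- ★ `±(1, rot3 u v) = ū·(±(1, v))·u`. [folklore] -/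
theorem gnoLetter_rot3 {u : ℍ} (hu : ‖u‖ = 1) (ε : Bool) (v : Fin 3 → ℝ) : gnoLetter ε (rot3 u v) = star u * gnoLetter ε v * u := by
  rw [gnoLetter_eq, gnoLetter_eq, gnomonicQuat_rot3 hu, mul_smul_comm, smul_mul_assoc]

/-- `rot3 u` is additive. [folklore] -/
theorem rot3_add (u : ℍ) (v w : Fin 3 → ℝ) : rot3 u (v + w) = rot3 u v + rot3 u w := by
  have hq : gnomonicQuat (v + w) = gnomonicQuat v + gnomonicQuat w - 1 := by
    ext <;> simp [gnomonicQuat]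
  ext i
  fin_cases i <;> simp [rot3, hq, mul_sub, sub_mul, mul_add, add_mul] <;> ring

/-- `rot3 u` commutes with scalars. [folklore] -/
theorem rot3_smul (u : ℍ) (c : ℝ) (v : Fin 3 → ℝ) : rot3 u (c • v) = c • rot3 u v := by
  have hq : gnomonicQuat (c • v) = c • gnomonicQuat v + (1 - c : ℝ) • (1 : ℍ) := by
    ext <;> simp [gnomonicQuat]
  ext i
  fin_cases i <;> simp [rot3, hq, mul_add, add_mul] <;> ring

/-- `rot3 u 0 = 0`. [folklore] -/
theorem rot3_zero (u : ℍ) : rot3 u 0 = 0 := by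
  have h := rot3_smul u 0 0
  rwa [zero_smul, zero_smul] at h

/-- `rot3 u` preserves the Euclidean norm for a unit `u`: `|rot3 u v|² = |v|²`. [folklore] -/
theorem normSq3_rot3 {u : ℍ} (hu : ‖u‖ = 1) (v : Fin 3 → ℝ) : normSq3 (rot3 u v) = normSq3 v := by
  have h1 : ‖gnomonicQuat (rot3 u v)‖ ^ 2 = ‖gnomonicQuat v‖ ^ 2 := by
    rw [gnomonicQuat_rot3 hu, norm_mul, norm_mul, norm_star, hu, one_mul, mul_one]
  rw [sq_norm_gnomonicQuat, sq_norm_gnomonicQuat, add_right_inj] at h1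
  simpa [normSq3] using h1

/-! ## §2 The chart point at a real hub and its conjugation -/

/-- `axisPoint (r : ℍ) = r`. [folklore] -/
theorem axisPoint_coe (r : ℝ) : axisPoint (r : ℍ) = (r : ℍ) := by
  ext <;> simp [axisPoint]

/-- At a real hub the arranged hub unit is `±1`: `radialUnit (axisPoint r) = (±1 : ℝ)` with the sign of `r ≠ 0`. [folklore] -/
theorem radialUnit_axisPoint_coe {r : ℝ} (hr : r ≠ 0) : ∃ s : ℝ, (s = 1 ∨ s = -1) ∧ radialUnit (axisPoint (r : ℍ)) = (s : ℍ) := by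
  rw [axisPoint_coe]
  rcases hr.lt_or_gt with h | h
  · exact ⟨-1, Or.inr rfl, by rw [radialUnit_coe_of_neg h]; push_cast; ring⟩
  · exact ⟨1, Or.inl rfl, by rw [radialUnit_coe_of_pos h]; push_cast; ring⟩

/-- `slaveP (±1) x = x̂`. [folklore] -/
theorem slaveP_sign {s : ℝ} (hs : s = 1 ∨ s = -1) (x : ℍ) : slaveP (s : ℍ) x = radialUnit x := by
  rw [ZeroModeSigma.slaveP]
  rcases hs with h | h <;> subst h <;> push_cast <;> simp

/-- `u·ū = 1` and `ū·u = 1` for a unit `u`. [folklore] -/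
theorem star_mul_self_of_unit {u : ℍ} (hu : ‖u‖ = 1) : star u * u = 1 ∧ u * star u = 1 := by
  have hn : Quaternion.normSq u = 1 := by rw [Quaternion.normSq_eq_norm_mul_self, hu, mul_one]
  refine ⟨?_, ?_⟩
  · rw [Quaternion.star_mul_self, hn]; push_cast; rfl
  · rw [Quaternion.self_mul_star, hn]; push_cast; rfl

/-- `ū·(±1)·u = ±1` for a unit `u` (real scalars are central). [folklore] -/
theorem conj_coe_of_unit {u : ℍ} (hu : ‖u‖ = 1) (s : ℝ) : star u * (s : ℍ) * u = (s : ℍ) := by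
  rw [← Quaternion.coe_commutes s (star u), mul_assoc, (star_mul_self_of_unit hu).1, mul_one]

/-- `x̂ ≠ 0` for `x ≠ 0`. [folklore] -/
theorem radialUnit_ne_zero' {x : ℍ} (hx : x ≠ 0) : radialUnit x ≠ 0 := by
  intro h
  have h1 := norm_radialUnit hx
  rw [h, norm_zero] at h1
  exact zero_ne_one h1

omit [NeZero L] in
/-- ★ **ROTATING ALL LETTERS AT A REAL HUB CONJUGATES THE CHART POINT**: for `r ≠ 0`, a unit `u` and `k := (quatToSU2 u)⁻¹`,
`blowUpPoint 1 (gnomonicPoint r ε (gnoRot u η)) = (k·(·)·k⁻¹)` of `blowUpPoint 1 (gnomonicPoint r ε η)` componentwise. [folklore] -/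
theorem blowUpPoint_gnomonicPoint_realHub_rot {r : ℝ} (hr : r ≠ 0) {u : ℍ} (hu : ‖u‖ = 1) (ε : GnoSign L) (η : GnoCoord L) :
    blowUpPoint (L := L) 1 (gnomonicPoint (r : ℍ) ε (gnoRot u η)) =
      ((fun m => (quatToSU2 u)⁻¹ * (blowUpPoint (L := L) 1 (gnomonicPoint (r : ℍ) ε η)).1 m * ((quatToSU2 u)⁻¹)⁻¹),
        (fun i => (quatToSU2 u)⁻¹ * (blowUpPoint (L := L) 1 (gnomonicPoint (r : ℍ) ε η)).2 i * ((quatToSU2 u)⁻¹)⁻¹)) := by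
  obtain ⟨s, hs, hrs⟩ := radialUnit_axisPoint_coe hr
  have hsu := slaveP_sign hs
  obtain ⟨huu, huu'⟩ := star_mul_self_of_unit hu
  have e1 : ∀ ζ : GnoCoord L, (blowUpPoint (L := L) 1 (gnomonicPoint (r : ℍ) ε ζ)).1 =
      leaderTuple (r : ℍ) ((gnoLetter ε.1.1 ζ.1.1, gnoLetter ε.1.2 ζ.1.2), gnoLetter ε.2.1 ζ.2.1) := by
    intro ζ
    show leaderTuple (r : ℍ) (dil3 1 (gnomonicPoint (r : ℍ) ε ζ).2.1) = _
    rw [dil3_one']; rfl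
  have e2 : ∀ (ζ : GnoCoord L) (i : Fol L), (blowUpPoint (L := L) 1 (gnomonicPoint (r : ℍ) ε ζ)).2 i = quatToSU2 (gnoLetter (ε.2.2 i) (ζ.2.2 i)) := by
    intro ζ i
    show quatToSU2 (dilateIm 1 ((gnomonicPoint (r : ℍ) ε ζ).2.2 i)) = _
    rw [dilateIm_one_apply]; rfl
  rw [inv_inv]
  refine Prod.ext ?_ ?_
  · rw [e1, e1]
    funext m
    fin_cases m
    · show leaderTuple _ _ 0 = (quatToSU2 u)⁻¹ * leaderTuple _ _ 0 * quatToSU2 u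
      rw [(leaderTuple_apply _ _).1, (leaderTuple_apply _ _).1]
      simp only [gnoRot]
      rw [gnoLetter_rot3 hu, quatToSU2_conj_unit hu (gnoLetter_ne_zero _ _)]
    · show leaderTuple _ _ 1 = (quatToSU2 u)⁻¹ * leaderTuple _ _ 1 * quatToSU2 u
      rw [(leaderTuple_apply _ _).2.1, (leaderTuple_apply _ _).2.1]
      simp only [gnoRot]
      rw [hrs, hsu, hsu, gnoLetter_rot3 hu, gnoLetter_rot3 hu, radialUnit_conj hu,
        ← quatToSU2_conj_unit hu (mul_ne_zero (radialUnit_ne_zero' (gnoLetter_ne_zero _ _)) (gnoLetter_ne_zero _ _))]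
      congr 1
      simp only [mul_assoc]
      rw [← mul_assoc u (star u), huu', one_mul]
    · show leaderTuple _ _ 2 = (quatToSU2 u)⁻¹ * leaderTuple _ _ 2 * quatToSU2 u
      rw [(leaderTuple_apply _ _).2.2.1, (leaderTuple_apply _ _).2.2.1]
      simp only [gnoRot]
      rw [gnoLetter_rot3 hu, quatToSU2_conj_unit hu (gnoLetter_ne_zero _ _)]
    · show leaderTuple _ _ 3 = (quatToSU2 u)⁻¹ * leaderTuple _ _ 3 * quatToSU2 u
      rw [(leaderTuple_apply _ _).2.2.2, (leaderTuple_apply _ _).2.2.2, hrs]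
      have hs0 : (s : ℍ) ≠ 0 := by
        rcases hs with h | h <;> subst h <;> simp
      rw [← quatToSU2_conj_unit hu hs0, conj_coe_of_unit hu]
  · funext i
    show _ = (quatToSU2 u)⁻¹ * (blowUpPoint (L := L) 1 (gnomonicPoint (r : ℍ) ε η)).2 i * quatToSU2 u
    rw [e2, e2]
    simp only [gnoRot]
    rw [gnoLetter_rot3 hu, quatToSU2_conj_unit hu (gnoLetter_ne_zero _ _)]

/-! ## §3 The deficit is invariant -/

/-- ★★ **APEX ISOTROPY**: at a real hub `r ≠ 0`, for a central background `χ` and every unit quaternion `u`,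
`F̂_{r,ε}(gnoRot u η) = F̂_{r,ε}(η)` — the σ-glued deficit is invariant under the simultaneous rotation of all gnomonic letters. [cite: tHooft1979] -/
theorem gnoDeficit_realHub_rot (z : Fin 3 → Bool) {χ : Site 3 L → SU2} (hχ : ∀ (x : Site 3 L) (k : SU2), k * χ x = χ x * k) {r : ℝ} (hr : r ≠ 0)
    {u : ℍ} (hu : ‖u‖ = 1) (ε : GnoSign L) (η : GnoCoord L) :
    gnoDeficit z χ (r : ℍ) ε (gnoRot u η) = gnoDeficit z χ (r : ℍ) ε η := by
  unfold gnoDeficit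
  rw [blowUpPoint_gnomonicPoint_realHub_rot hr hu ε η]
  exact chartDeficit_conj z hχ _ _

/-- ★★ The same for the trivial background `χ ≡ 1` (the one of skeleton ➎). [cite: tHooft1979] -/
theorem gnoDeficit_one_realHub_rot (z : Fin 3 → Bool) {r : ℝ} (hr : r ≠ 0) {u : ℍ} (hu : ‖u‖ = 1) (ε : GnoSign L) (η : GnoCoord L) :
    gnoDeficit z (fun _ => (1 : SU2)) (r : ℍ) ε (gnoRot u η) = gnoDeficit z (fun _ => (1 : SU2)) (r : ℍ) ε η :=
  gnoDeficit_realHub_rot z (fun _ k => by rw [mul_one, one_mul]) hr hu ε η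

end Summit.QuantumFields.YangMills.Theorems.SwapVirialDeficit.BlowUpRing

end
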